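import Mathlib.Analysis.SpecialFunctions.Arsinh
import Mathlib.Analysis.SpecialFunctions.Arcosh
import Mathlib.Analysis.SpecialFunctions.Trigonometric.DerivHyp
import Mathlib.Analysis.Calculus.MeanValue
import Mathlib.LinearAlgebra.Matrix.NonsingularInverse
import Mathlib.Data.ZMod.Basic
import HarnessLib

/-!
# BalabanUVNodes ∕ N15 — THE KING-MODEL RUNG (PART Ϲ-a): THE MASSIVE CYCLE RESOLVENT IN CLOSED FORM
# `((2+x)·1 − S − S⁻¹)⁻¹(s,t) = cosh(ω(val(t−s) − n∕2)) ∕ (2 sinh ω · sinh(ωn∕2))`, `2 sinh(ω∕2) = √x`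
# — the time-direction kernel behind the transfer-matrix form of King's torus two-point functions

HONEST FRAMING.  Count-neutral (cell `pub-ymgap`, seat `pub-ymgap-dag-n15-e` g38; `--supports stmt-QuantumFields-27366 --as helper` = K3⁸).
TEMPLATE-LITERATURE INFRASTRUCTURE for C. King, Commun. Math. Phys. **102** (1986) 649–677 [King1986] §4 (the free massive lattice
operators `Δ^η + m²` of (4.4) p.670 on finite tori, `A = 0`): this file is the `d = 1` factor of those operators — the massive
second-difference operator on the CYCLE `ℤ∕n` — and its inverse in closed form, i.e. the elementary transfer-matrix computation of
lattice field theory: Montvay–Münster, *Quantum Fields on a Lattice* (1994) [MontvayMunster1994] §2.1.2 (timeslice correlations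
(2.18)–(2.20), spectral form (2.49)) and §2.2.1 (free field: the energy–momentum relation `2 sinh(ω₀(p)∕2) = (m₀² + p̂²)^{1∕2}` (2.74),
`cosh ω₀ = 1 + ½(m₀² + p̂²)` (2.75), the physical mass `m̄₀ = 2 log((1 + m₀²∕4)^{1∕2} + m₀∕2)` (2.78) and `m̄₀ = m₀{1 + O(a²m₀²)}` (2.82));
Drouffe–Zuber, Phys. Rep. **102** (1983) [DrouffeZuber1983] (3.43)–(3.46) p.41 (`G(p,τ) ~ e^{−E₀(p)τ}`, `aE₀(p) = Arg cosh(cosh m₀ + 1 − cos p)`).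
Nothing here is specific to Bałaban's covariant objects; NOT a node discharge (N15 is booked through n15-a's knit, untouched); nothing
continuum ∕ ℝ⁴ ∕ OS axioms ∕ mass gap of Yang–Mills ∕ Clay.  0 `sorry`; standard axioms.

OBJECTS (definitions, explicit closed forms).
* `latticeMass x = 2·arsinh(√x∕2)` — (2.74)∕(2.78) verbatim: for `x ≥ 0` the unique `ω ≥ 0` with `cosh ω = 1 + x∕2` (2.75).
* `cycleOp n x : Matrix (ZMod n) (ZMod n) ℝ`, `(s,t) ↦ (2+x)[t = s] − ([t = s+1] + [t = s−1])` — `x + (−Δ)` on the cycle `ℤ∕n` with the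
  SAME wrap-around convention as the tree's `King1986.Torus.lapF` (both `±` neighbours summed; for `n ≤ 2` they coincide).
* `cycleProfile n x r = cosh(ω·(r − n∕2))`, `cycleGreen n x t = cycleProfile n x (val t) ∕ (2 sinh ω sinh(ωn∕2))`.

WHAT THIS FILE PROVES (kernel).  §1 `latticeMass_nonneg ∕ _pos ∕ _zero`, `sinh_half_latticeMass` ((2.74)), ★ `cosh_latticeMass` ((2.75)),
`two_add_eq_two_mul_cosh`, `latticeMass_eq_arcosh` ((2.76)), `latticeMass_le_latticeMass ∕ _lt_` (increasing in `x ≥ 0`), ★ `latticeMass_le_sqrt`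
(`ω ≤ √x`), ★ `sub_cube_le_arsinh` (`y − y³∕6 ≤ arsinh y`, `y ≥ 0`, by the mean-value monotonicity test), ★★ **`sqrt_sub_le_latticeMass`**
(`√x − (√x)³∕24 ≤ ω` — with `latticeMass_le_sqrt` the QUANTIFIED (2.82): for `x = m²η²` the mass per unit length `ω∕η ∈ [m − m³η²∕24, m]`).
§2 `cycleOp_transl`, `cycleOp_comm`, ★ `cycleOp_mulVec_apply` (the three-point stencil).  §3 `cycleProfile_symm` (`P(n − r) = P r`),
★ `cycleProfile_step` (`P(r+1) + P(r−1) = (2+x)P r` — the plane wave at imaginary momentum), `cycleProfile_boundary` (`(2+x)P 0 − 2P 1 =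
2 sinh ω sinh(ωn∕2)` — the defect at the source), `val` bookkeeping `cycleProfile_val_add_one ∕ val_sub_one_of_ne_zero ∕ cycleProfile_val_neg_one`,
`cycleGreen_neg` (even), ★★ **`cycleOp_mulVec_cycleGreen`** (`(x + (−Δ))g = δ₀`), ★★ `cycleOp_mulVec_cycleGreen_sub` (every source),
★★ `cycleOp_mul_greenMatrix` (`A·G = 1`), ★★★ **`cycleOp_inv_apply`** (`((2+x) − S − S⁻¹)⁻¹(s,t) = cosh(ω(val(t−s) − n∕2))∕(2 sinh ω sinh(ωn∕2))`
— THE MASSIVE CYCLE RESOLVENT IN CLOSED FORM, every period `n ≥ 1`, every `x > 0`), `isUnit_cycleOp`, ★★ **`eq_smul_cycleGreen_of_recurrence`**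
(UNIQUENESS: a real solution of the stencil equation with source `r·δ₀` is `r·g`).

HONEST SCOPE.  Pure one-dimensional linear algebra and real analysis; `x > 0` (massive) throughout the inverse statements (at `x = 0` the cycle
operator has the constant zero mode).  Readings (complex-valued uniqueness, positivity, image form, torus-vs-infinite-axis comparison, `n → ∞`
limit) are in the companion `…KingModelCycleResolventReadings`; the timeslice channels of King's `B⁻¹ = (c(−Δ)+m²)⁻¹` and of the RG block-field
covariance `(Δ^{(K)})⁻¹` that REDUCE to this resolvent are in `…KingModelTorusTimeSlices` ∕ `…KingModelBlockFieldMassGap`.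
Locators: [MontvayMunster1994] §2.1.2 (2.18)–(2.20), (2.49); §2.2.1 (2.74)–(2.78), (2.82). [DrouffeZuber1983] (3.43)–(3.46) p.41. [King1986] (4.4) p.670.
-/

noncomputable section

open scoped BigOperators
open Finset Matrix Real

namespace Summit.QuantumFields.YangMills.BalabanUVNodes.N15KingModelRung.TorusSpectral

/-! ## §1 The lattice mass `ω(x) = 2·arsinh(√x∕2)`: `cosh ω = 1 + x∕2` -/

section LatticeMass

/-- THE LATTICE MASS `ω(x) := 2·arsinh(√x∕2)` (`2 sinh(ω∕2) = √x`) — for `x ≥ 0` the unique `ω ≥ 0` with `cosh ω = 1 + x∕2`: the energy of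
the free lattice field at `x = m₀² + p̂²`, i.e. the decay rate per lattice step of the resolvent of `(2 + x) − S − S⁻¹` (King's `Δ^η + m²` (4.4)
in one direction, continued to imaginary momentum). [cite: MontvayMunster1994, §2.2.1 (2.74)–(2.76), (2.78)] -/
def latticeMass (x : ℝ) : ℝ := 2 * Real.arsinh (Real.sqrt x / 2)

/-- `ω(x) ≥ 0`. [folklore] -/
theorem latticeMass_nonneg (x : ℝ) : 0 ≤ latticeMass x := by
  unfold latticeMass
  have h : 0 ≤ Real.arsinh (Real.sqrt x / 2) := Real.arsinh_nonneg_iff.mpr (by positivity)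
  linarith

/-- `ω(x) > 0` for `x > 0`. [folklore] -/
theorem latticeMass_pos {x : ℝ} (hx : 0 < x) : 0 < latticeMass x := by
  unfold latticeMass
  have h : 0 < Real.arsinh (Real.sqrt x / 2) := Real.arsinh_pos_iff.mpr (by positivity)
  linarith

/-- `ω(0) = 0` (the massless cycle has no gap). [folklore] -/
theorem latticeMass_zero : latticeMass 0 = 0 := by simp [latticeMass]

/-- `sinh(ω∕2) = √x∕2` — the energy–momentum relation in Montvay–Münster's form `2 sinh(ω₀∕2) = (m₀² + p̂²)^{1∕2}`.
[cite: MontvayMunster1994, §2.2.1 (2.74)] -/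
theorem sinh_half_latticeMass (x : ℝ) : Real.sinh (latticeMass x / 2) = Real.sqrt x / 2 := by
  unfold latticeMass
  rw [mul_div_cancel_left₀ _ (two_ne_zero), Real.sinh_arsinh]

/-- ★ `cosh ω(x) = 1 + x∕2` (`x ≥ 0`): the defining equation of the lattice mass. [cite: MontvayMunster1994, §2.2.1 (2.75)] -/
theorem cosh_latticeMass {x : ℝ} (hx : 0 ≤ x) : Real.cosh (latticeMass x) = 1 + x / 2 := by
  rw [show latticeMass x = 2 * (latticeMass x / 2) by ring, Real.cosh_two_mul, Real.cosh_sq', sinh_half_latticeMass, div_pow,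
    Real.sq_sqrt hx]
  ring

/-- `2 + x = 2·cosh ω(x)` (`x ≥ 0`) — the diagonal of the stencil is twice the hyperbolic cosine of the rate. [folklore] -/
theorem two_add_eq_two_mul_cosh {x : ℝ} (hx : 0 ≤ x) : 2 + x = 2 * Real.cosh (latticeMass x) := by rw [cosh_latticeMass hx]; ring

/-- `ω(x) = arcosh(1 + x∕2)` (`x ≥ 0`). [cite: MontvayMunster1994, §2.2.1 (2.76); DrouffeZuber1983, (3.46) p.41] -/
theorem latticeMass_eq_arcosh {x : ℝ} (hx : 0 ≤ x) : latticeMass x = Real.arcosh (1 + x / 2) := by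
  rw [← cosh_latticeMass hx, Real.arcosh_cosh (latticeMass_nonneg x)]

/-- `ω` is increasing. [folklore] -/
theorem latticeMass_le_latticeMass {x y : ℝ} (hxy : x ≤ y) : latticeMass x ≤ latticeMass y := by
  have h : Real.sqrt x / 2 ≤ Real.sqrt y / 2 := by gcongr
  have := Real.arsinh_le_arsinh.mpr h
  unfold latticeMass; linarith

/-- `ω` is strictly increasing on `x ≥ 0`. [folklore] -/
theorem latticeMass_lt_latticeMass {x y : ℝ} (hx : 0 ≤ x) (hxy : x < y) : latticeMass x < latticeMass y := by
  have h : Real.sqrt x / 2 < Real.sqrt y / 2 := by have := Real.sqrt_lt_sqrt hx hxy; linarith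
  have := Real.arsinh_lt_arsinh.mpr h
  unfold latticeMass; linarith

/-- ★ `ω(x) ≤ √x`: the lattice mass never exceeds the continuum mass (`arsinh y ≤ y` for `y ≥ 0`). [folklore] -/
theorem latticeMass_le_sqrt (x : ℝ) : latticeMass x ≤ Real.sqrt x := by
  have h1 : Real.sqrt x / 2 ≤ Real.sinh (Real.sqrt x / 2) := Real.self_le_sinh_iff.mpr (by positivity)
  have h2 := Real.arsinh_le_arsinh.mpr h1
  rw [Real.arsinh_sinh] at h2
  unfold latticeMass; linarith

/-- ★ `y − y³∕6 ≤ arsinh y` for `y ≥ 0` — the cubic lower Taylor bound of `arsinh`, by the monotonicity test on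
`φ(y) = arsinh y − y + y³∕6` (`φ′ = (1+y²)^{−1∕2} − 1 + y²∕2 ≥ 0`). [folklore] -/
theorem sub_cube_le_arsinh {y : ℝ} (hy : 0 ≤ y) : y - y ^ 3 / 6 ≤ Real.arsinh y := by
  let φ : ℝ → ℝ := fun u => Real.arsinh u - u + u ^ 3 / 6
  have hderiv : ∀ u, HasDerivAt φ ((Real.sqrt (1 + u ^ 2))⁻¹ - 1 + 3 * u ^ 2 / 6) u := by
    intro u
    have h1 := Real.hasDerivAt_arsinh u
    have h2 := hasDerivAt_id u
    have h3 : HasDerivAt (fun u : ℝ => u ^ 3 / 6) (3 * u ^ 2 / 6) u := by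
      have := (hasDerivAt_pow 3 u).div_const 6
      simpa using this
    have h4 : HasDerivAt (fun u : ℝ => Real.arsinh u - u + u ^ 3 / 6)
        ((Real.sqrt (1 + u ^ 2))⁻¹ - 1 + 3 * u ^ 2 / 6) u := (h1.sub h2).add h3
    exact h4
  have hpos : ∀ u, 0 ≤ (Real.sqrt (1 + u ^ 2))⁻¹ - 1 + 3 * u ^ 2 / 6 := by
    intro u
    have hs : 0 < Real.sqrt (1 + u ^ 2) := Real.sqrt_pos.mpr (by positivity)
    by_cases hu : u ^ 2 ≤ 2
    · -- `(1 − u²∕2)·√(1+u²) ≤ 1`, i.e. `1 − u²∕2 ≤ (1+u²)^{−1∕2}`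
      have hnn : 0 ≤ 1 - u ^ 2 / 2 := by linarith
      have hkey : (1 - u ^ 2 / 2) * Real.sqrt (1 + u ^ 2) ≤ 1 := by
        have hsq : ((1 - u ^ 2 / 2) * Real.sqrt (1 + u ^ 2)) ^ 2 ≤ 1 := by
          rw [mul_pow, Real.sq_sqrt (by positivity)]
          nlinarith [sq_nonneg u, sq_nonneg (u ^ 2), mul_nonneg (sq_nonneg u) (sq_nonneg u)]
        have hnn' : 0 ≤ (1 - u ^ 2 / 2) * Real.sqrt (1 + u ^ 2) := mul_nonneg hnn hs.le
        nlinarith [hsq, hnn']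
      have h1 : 1 - u ^ 2 / 2 ≤ (Real.sqrt (1 + u ^ 2))⁻¹ := by
        rw [← one_div, le_div_iff₀ hs]
        exact hkey
      linarith
    · have hu' : 2 < u ^ 2 := not_le.mp hu
      have : 0 < (Real.sqrt (1 + u ^ 2))⁻¹ := inv_pos.mpr hs
      nlinarith [this, hu']
  have hdiff : Differentiable ℝ φ := fun u => (hderiv u).differentiableAt
  have hmono : MonotoneOn φ (Set.Ici 0) := by
    refine monotoneOn_of_deriv_nonneg (convex_Ici 0) hdiff.continuous.continuousOn
      (hdiff.differentiableOn) fun u _ => ?_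
    rw [(hderiv u).deriv]
    exact hpos u
  have h0 : φ 0 = 0 := by simp [φ]
  have := hmono (Set.mem_Ici.mpr le_rfl) (Set.mem_Ici.mpr hy) hy
  rw [h0] at this
  simp only [φ] at this
  linarith

/-- ★★ **`√x − (√x)³∕24 ≤ ω(x)`** (`x ≥ 0`) — with `latticeMass_le_sqrt` the TWO-SIDED η-RATE LETTER: for `x = m²η²` the lattice mass per unit
length `ω∕η` lies in `[m − m³η²∕24, m]` (Montvay–Münster's `m̄₀ = m₀{1 + O(a²m₀²)}` with the constant). [cite: MontvayMunster1994, §2.2.1 (2.82)] -/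
theorem sqrt_sub_le_latticeMass {x : ℝ} (hx : 0 ≤ x) : Real.sqrt x - Real.sqrt x ^ 3 / 24 ≤ latticeMass x := by
  unfold latticeMass
  have h := sub_cube_le_arsinh (y := Real.sqrt x / 2) (by positivity)
  have _hx := hx
  nlinarith [h]

end LatticeMass

/-! ## §2 The massive second-difference operator `(2+x) − S − S⁻¹` on the cycle `ℤ∕n` -/

section CycleOp

variable (n : ℕ)

/-- THE CYCLE OPERATOR `x + (−Δ)` on `ℤ∕n`: `(s,t) ↦ (2+x)[t = s] − ([t = s+1] + [t = s−1])` — the `d = 1` instance of the stencil of the tree's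
`King1986.Torus.lapF` (both `±` neighbours summed, with the same wrap-around convention for `n ≤ 2`). [cite: King1986, (4.4) p.670] -/
def cycleOp (x : ℝ) : Matrix (ZMod n) (ZMod n) ℝ := fun s t =>
  (2 + x) * (if t = s then 1 else 0) - ((if t = s + 1 then 1 else 0) + (if t = s - 1 then 1 else 0))

/-- The cycle operator is translation invariant. [folklore] -/
theorem cycleOp_transl (x : ℝ) (s t u : ZMod n) : cycleOp n x (s + u) (t + u) = cycleOp n x s t := by
  unfold cycleOp
  have h1 : (t + u = s + u) ↔ (t = s) := add_left_inj u
  have h2 : (t + u = s + u + 1) ↔ (t = s + 1) := by rw [add_right_comm, add_left_inj]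
  have h3 : (t + u = s + u - 1) ↔ (t = s - 1) := by rw [add_sub_right_comm, add_left_inj]
  simp only [h1, h2, h3]

/-- The cycle operator is symmetric. [folklore] -/
theorem cycleOp_comm (x : ℝ) (s t : ZMod n) : cycleOp n x t s = cycleOp n x s t := by
  unfold cycleOp
  have h1 : (s = t) ↔ (t = s) := eq_comm
  have h2 : (s = t + 1) ↔ (t = s - 1) := ⟨fun h => by rw [h, add_sub_cancel_right], fun h => by rw [h, sub_add_cancel]⟩
  have h3 : (s = t - 1) ↔ (t = s + 1) := ⟨fun h => by rw [h, sub_add_cancel], fun h => by rw [h, add_sub_cancel_right]⟩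
  simp only [h1, h2, h3]
  ring

variable [NeZero n]

/-- ★ THE THREE-POINT STENCIL: `((x + (−Δ))f)(s) = (2+x)f(s) − (f(s+1) + f(s−1))`. [cite: King1986, (4.4) p.670] -/
theorem cycleOp_mulVec_apply (x : ℝ) (f : ZMod n → ℝ) (s : ZMod n) :
    (cycleOp n x *ᵥ f) s = (2 + x) * f s - (f (s + 1) + f (s - 1)) := by
  have h : ∀ t, cycleOp n x s t * f t
      = (2 + x) * (if t = s then f t else 0) - ((if t = s + 1 then f t else 0) + (if t = s - 1 then f t else 0)) := by
    intro t; unfold cycleOp; split_ifs <;> ring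
  simp only [Matrix.mulVec, dotProduct, h, Finset.sum_sub_distrib, Finset.sum_add_distrib, ← Finset.mul_sum,
    Finset.sum_ite_eq', Finset.mem_univ, if_true]

end CycleOp

/-! ## §3 The closed form: `cosh(ω(r − n∕2))∕(2 sinh ω sinh(ωn∕2))` inverts the cycle operator -/

section ClosedForm

variable (n : ℕ)

/-- THE PROFILE `P(r) = cosh(ω(x)·(r − n∕2))` — a `cosh` centred at half the period. [folklore] -/
def cycleProfile (x r : ℝ) : ℝ := Real.cosh (latticeMass x * (r - n / 2))

/-- THE CYCLE GREEN's FUNCTION `g(t) = cosh(ω(val t − n∕2)) ∕ (2 sinh ω · sinh(ωn∕2))` (`val t ∈ {0,…,n−1}` the standard representative) —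
the periodic-time form of the timeslice correlation `C(t) ∝ e^{−E t}`. [cite: MontvayMunster1994, §2.1.2 (2.24), (2.49); DrouffeZuber1983, (3.43) p.41] -/
def cycleGreen (x : ℝ) (t : ZMod n) : ℝ :=
  cycleProfile n x (t.val : ℝ) / (2 * Real.sinh (latticeMass x) * Real.sinh (latticeMass x * n / 2))

/-- `P(n − r) = P(r)` (reflection symmetry about half the period). [folklore] -/
theorem cycleProfile_symm (x r : ℝ) : cycleProfile n x (n - r) = cycleProfile n x r := by
  unfold cycleProfile
  rw [← Real.cosh_neg]
  congr 1
  ring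

/-- ★ THE PLANE-WAVE EQUATION AT IMAGINARY MOMENTUM: `P(r+1) + P(r−1) = (2+x)·P(r)` (`x ≥ 0`; `cosh(a+ω) + cosh(a−ω) = 2cosh ω cosh a`).
[cite: King1986, (4.4) p.670] -/
theorem cycleProfile_step {x : ℝ} (hx : 0 ≤ x) (r : ℝ) :
    cycleProfile n x (r + 1) + cycleProfile n x (r - 1) = (2 + x) * cycleProfile n x r := by
  unfold cycleProfile
  rw [two_add_eq_two_mul_cosh hx,
    show latticeMass x * (r + 1 - n / 2) = latticeMass x * (r - n / 2) + latticeMass x by ring,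
    show latticeMass x * (r - 1 - n / 2) = latticeMass x * (r - n / 2) - latticeMass x by ring,
    Real.cosh_add, Real.cosh_sub]
  ring

/-- THE DEFECT AT THE SOURCE: `(2+x)·P(0) − 2·P(1) = 2 sinh ω · sinh(ωn∕2)` (`x ≥ 0`). [folklore] -/
theorem cycleProfile_boundary {x : ℝ} (hx : 0 ≤ x) :
    (2 + x) * cycleProfile n x 0 - 2 * cycleProfile n x 1
      = 2 * Real.sinh (latticeMass x) * Real.sinh (latticeMass x * n / 2) := by
  unfold cycleProfile
  rw [two_add_eq_two_mul_cosh hx,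
    show latticeMass x * (0 - (n : ℝ) / 2) = -(latticeMass x * n / 2) by ring,
    show latticeMass x * (1 - (n : ℝ) / 2) = latticeMass x - latticeMass x * n / 2 by ring,
    Real.cosh_neg, Real.cosh_sub]
  ring

/-- The normalising denominator `2 sinh ω sinh(ωn∕2)` is positive (`x > 0`, `n ≥ 1`). [folklore] -/
theorem cycleDenom_pos [NeZero n] {x : ℝ} (hx : 0 < x) :
    0 < 2 * Real.sinh (latticeMass x) * Real.sinh (latticeMass x * n / 2) := by
  have hω := latticeMass_pos hx
  have hn : (0 : ℝ) < n := by exact_mod_cast Nat.pos_of_ne_zero (NeZero.ne n)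
  have h1 : 0 < Real.sinh (latticeMass x) := Real.sinh_pos_iff.mpr hω
  have h2 : 0 < Real.sinh (latticeMass x * n / 2) := Real.sinh_pos_iff.mpr (by positivity)
  positivity

variable [NeZero n]

/-- `val(t + 1)` bookkeeping: `P(val(t+1)) = P(val t + 1)` (including the wrap `t = n − 1`, where `P(0) = P(n)`). [folklore] -/
theorem cycleProfile_val_add_one (x : ℝ) (t : ZMod n) :
    cycleProfile n x (((t + 1 : ZMod n).val : ℕ) : ℝ) = cycleProfile n x ((t.val : ℝ) + 1) := by
  have h1 : (1 : ZMod n).val = 1 % n := ZMod.val_one_eq_one_mod n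
  rcases Nat.lt_or_ge (t.val + 1) n with hlt | hge
  · have hn1 : 1 % n = 1 := Nat.mod_eq_of_lt (by omega)
    have : (t + 1 : ZMod n).val = t.val + 1 := by
      rw [ZMod.val_add, h1, hn1, Nat.mod_eq_of_lt hlt]
    rw [this]; push_cast; rfl
  · -- `t.val + 1 = n`: the successor wraps to `0`, and `P(0) = P(n) = P(t.val + 1)`
    have heq : t.val + 1 = n := le_antisymm (Nat.succ_le_of_lt (ZMod.val_lt t)) hge
    have h0 : (t + 1 : ZMod n) = 0 := by
      have : ((t.val + 1 : ℕ) : ZMod n) = 0 := by rw [heq, ZMod.natCast_self]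
      rw [← this]; push_cast; rw [ZMod.natCast_zmod_val]
    rw [h0, ZMod.val_zero, show ((t.val : ℝ) + 1) = (n : ℝ) - 0 by rw [sub_zero]; exact_mod_cast heq, cycleProfile_symm]
    push_cast; rfl

/-- `val(t − 1)` bookkeeping away from the source: for `t ≠ 0`, `val(t − 1) = val t − 1`. [folklore] -/
theorem val_sub_one_of_ne_zero {t : ZMod n} (ht : t ≠ 0) : ((t - 1 : ZMod n).val : ℝ) = (t.val : ℝ) - 1 := by
  have hpos : 0 < t.val := Nat.pos_of_ne_zero (fun h => ht ((ZMod.val_eq_zero t).mp h))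
  have h1 : (1 : ZMod n).val ≤ t.val := by
    rw [ZMod.val_one_eq_one_mod]
    exact le_trans (Nat.mod_le 1 n) hpos
  rw [ZMod.val_sub h1, ZMod.val_one_eq_one_mod]
  rcases Nat.lt_or_ge 1 n with hn | hn
  · rw [Nat.mod_eq_of_lt hn]; push_cast [hpos]; ring
  · -- `n = 1`: every element is `0`
    exfalso
    have : n = 1 := le_antisymm hn (Nat.pos_of_ne_zero (NeZero.ne n))
    subst this
    exact ht (Subsingleton.elim _ _)

/-- `val(−1)` bookkeeping at the source: `P(val(0 − 1)) = P(1)` (`val(−1) = n − 1` and `P(n−1) = P(1)`; for `n = 1` both sides are `P` at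
`∓½`, equal by evenness). [folklore] -/
theorem cycleProfile_val_neg_one (x : ℝ) : cycleProfile n x (((0 - 1 : ZMod n).val : ℕ) : ℝ) = cycleProfile n x 1 := by
  rw [zero_sub]
  obtain ⟨k, hk⟩ : ∃ k, n = k + 1 := Nat.exists_eq_succ_of_ne_zero (NeZero.ne n)
  subst hk
  rw [ZMod.val_neg_one, show ((k : ℕ) : ℝ) = ((k + 1 : ℕ) : ℝ) - 1 by push_cast; ring, cycleProfile_symm]

/-- The cycle Green's function is even: `g(−t) = g(t)`. [folklore] -/
theorem cycleGreen_neg (x : ℝ) (t : ZMod n) : cycleGreen n x (-t) = cycleGreen n x t := by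
  unfold cycleGreen
  congr 1
  rw [ZMod.neg_val]
  split_ifs with h
  · rw [h, ZMod.val_zero]
  · rw [Nat.cast_sub (ZMod.val_lt t).le, cycleProfile_symm]

/-- ★★ **THE CLOSED FORM INVERTS THE CYCLE OPERATOR AT THE ORIGIN**: `((2+x) − S − S⁻¹)·g = δ₀` (`x > 0`, every `n ≥ 1`).
[cite: MontvayMunster1994, §2.2.1 (2.72)–(2.75)] -/
theorem cycleOp_mulVec_cycleGreen {x : ℝ} (hx : 0 < x) :
    cycleOp n x *ᵥ cycleGreen n x = Pi.single (0 : ZMod n) (1 : ℝ) := by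
  have h1 : Real.sinh (latticeMass x) ≠ 0 := (Real.sinh_pos_iff.mpr (latticeMass_pos hx)).ne'
  have h2 : Real.sinh (latticeMass x * n / 2) ≠ 0 := by
    have hn : (0 : ℝ) < n := by exact_mod_cast Nat.pos_of_ne_zero (NeZero.ne n)
    exact (Real.sinh_pos_iff.mpr (by have := latticeMass_pos hx; positivity)).ne'
  funext s
  rw [cycleOp_mulVec_apply]
  by_cases hs : s = 0
  · subst hs
    rw [Pi.single_eq_same]
    unfold cycleGreen
    rw [cycleProfile_val_add_one, cycleProfile_val_neg_one, ZMod.val_zero, Nat.cast_zero, zero_add]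
    have key := cycleProfile_boundary n hx.le
    field_simp
    linear_combination key
  · rw [Pi.single_eq_of_ne hs]
    unfold cycleGreen
    rw [cycleProfile_val_add_one, val_sub_one_of_ne_zero n hs]
    have step := cycleProfile_step n hx.le (s.val : ℝ)
    field_simp
    linear_combination -step

/-- ★★ The translated closed form inverts the cycle operator at every source: `((2+x) − S − S⁻¹)·g(· − a) = δ_a`. [folklore] -/
theorem cycleOp_mulVec_cycleGreen_sub {x : ℝ} (hx : 0 < x) (a : ZMod n) :
    cycleOp n x *ᵥ (fun u => cycleGreen n x (u - a)) = Pi.single a (1 : ℝ) := by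
  funext s
  have h := congr_fun (cycleOp_mulVec_cycleGreen n hx) (s - a)
  rw [cycleOp_mulVec_apply] at h ⊢
  rw [show s + 1 - a = s - a + 1 by ring, show s - 1 - a = s - a - 1 by ring, h]
  by_cases hs : s = a
  · subst hs; rw [sub_self, Pi.single_eq_same, Pi.single_eq_same]
  · rw [Pi.single_eq_of_ne (sub_ne_zero.mpr hs), Pi.single_eq_of_ne hs]

/-- ★★ `A·G = 1` for the matrix `G(s,t) = g(t − s)`. [folklore] -/
theorem cycleOp_mul_greenMatrix {x : ℝ} (hx : 0 < x) :
    cycleOp n x * (Matrix.of fun s t => cycleGreen n x (t - s)) = 1 := by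
  ext s t
  have h := congr_fun (cycleOp_mulVec_cycleGreen_sub n hx t) s
  rw [Matrix.mulVec, dotProduct] at h
  · rw [Matrix.mul_apply, Matrix.one_apply]
    have : ∀ u, cycleOp n x s u * (Matrix.of fun s t => cycleGreen n x (t - s)) u t = cycleOp n x s u * cycleGreen n x (u - t) := by
      intro u
      rw [Matrix.of_apply, ← cycleGreen_neg n x (t - u), neg_sub]
    simp_rw [this]
    rw [h, Pi.single_apply]

/-- The cycle operator is invertible (`x > 0`). [folklore] -/
theorem isUnit_cycleOp {x : ℝ} (hx : 0 < x) : IsUnit (cycleOp n x) :=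
  IsUnit.of_mul_eq_one _ (cycleOp_mul_greenMatrix n hx)

/-- ★★★ **THE MASSIVE CYCLE RESOLVENT IN CLOSED FORM**: `((2+x) − S − S⁻¹)⁻¹(s,t) = cosh(ω·(val(t−s) − n∕2)) ∕ (2 sinh ω · sinh(ωn∕2))`,
`cosh ω = 1 + x∕2` — every period `n ≥ 1`, every `x > 0`.  This is the time-direction factor of the transfer-matrix form of a free
lattice two-point function on a periodic time axis. [cite: MontvayMunster1994, §2.1.2 (2.49), §2.2.1 (2.72)–(2.76); DrouffeZuber1983, (3.43)–(3.46) p.41] -/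
theorem cycleOp_inv_apply {x : ℝ} (hx : 0 < x) (s t : ZMod n) :
    (cycleOp n x)⁻¹ s t = cycleGreen n x (t - s) := by
  rw [Matrix.inv_eq_right_inv (cycleOp_mul_greenMatrix n hx), Matrix.of_apply]

/-- ★★ **UNIQUENESS**: a real solution of the stencil equation `(2+x)f(s) − f(s+1) − f(s−1) = r·[s = 0]` on the cycle IS `r·g` (`x > 0`).
[folklore] -/
theorem eq_smul_cycleGreen_of_recurrence {x : ℝ} (hx : 0 < x) (f : ZMod n → ℝ) (r : ℝ)
    (h : ∀ s, (2 + x) * f s - (f (s + 1) + f (s - 1)) = if s = 0 then r else 0) :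
    f = r • cycleGreen n x := by
  have hA : cycleOp n x *ᵥ f = Pi.single (0 : ZMod n) r := by
    funext s; rw [cycleOp_mulVec_apply, h, Pi.single_apply]
  have hdet : IsUnit (cycleOp n x).det := (Matrix.isUnit_iff_isUnit_det _).mp (isUnit_cycleOp n hx)
  calc f = ((cycleOp n x)⁻¹ * cycleOp n x) *ᵥ f := by rw [Matrix.nonsing_inv_mul _ hdet, Matrix.one_mulVec]
    _ = (cycleOp n x)⁻¹ *ᵥ Pi.single (0 : ZMod n) r := by rw [← Matrix.mulVec_mulVec, hA]
    _ = r • cycleGreen n x := by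
        funext t
        rw [Matrix.mulVec, dotProduct, Finset.sum_eq_single (0 : ZMod n), Pi.single_eq_same, cycleOp_inv_apply n hx,
          zero_sub, cycleGreen_neg, Pi.smul_apply, smul_eq_mul, mul_comm]
        · intro u _ hu; rw [Pi.single_eq_of_ne hu, mul_zero]
        · intro h0; exact absurd (Finset.mem_univ _) h0

end ClosedForm

end Summit.QuantumFields.YangMills.BalabanUVNodes.N15KingModelRung.TorusSpectral
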